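import Summits.Schanuel.Schanuel.Theorems.RootDecomp1KCollarWall04

/-!
# RootDecomp1KCollarWall — lens 1, generation 49, node 8 «THE COLLAR WALL: item 33364 decided hyp-free at the exhibited fixed-finite-order tuple z♮₃ = (1, ℓ₂, ρ♮₂) and its π-twin, via a class-level wall engine for DyadicCollarLiouville against any θ⃗ with MvPolyMeasure» — continuation (RootDecomp1KCollarWall05): §4b the member tuples, every binder of item 33364, the item instance

(lens-1 g49 HOME kernel K = HOME/decomp-schanuel-lens-1/g49/CollarWall.lean 402bd26b…, 1041 l, imports …RootDecomp1KCollarCell05 + …RootDecomp1KNWMeasureHolds BY NAME; P CollarWallProbe.lean / C CollarWallCtrl.lean; memo NODE-g49.md; CLAIM L2443, EX-ANTE PRICE + CHECKLIST K-g49 L2444, NODE L2450 / REQUEST L2451; critic VERDICT L2454: CLEARED AS PRICED — ONE CELL ×1 «COLLAR WALL», RULE K-R38, PORT GO. Port by census-1 gen 21 as `RootDecomp1KCollarWall01–05` along K's §1–§4 with §4 cut at its §4a/§4b sub-headers by the 400-line file cap: 01 = §1 (W1) `mvMaxval₂`, `clearPoly_ne_zero_of_twoAdic` — T1 in the `clearPoly`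 frame (the cleared θ-polynomial at 2-adically interlaced slots is ≠ 0); 02 = §2 (W2) `collar_balance_false` + (W3) **`algebraicIndependent_collar_of_mvPolyMeasure (hρ : DyadicCollarLiouville ρ) (hθ : MvPolyMeasure θ)`** — the COLLAR WALL ENGINE (resonant-height simultaneous specialisation against a transcendental block of polynomial measure); 03 = §3 (W4) the walls for the WHOLE class, hyp-free: `sb_collarWall3`, `sb_collarWall3_pi`, `finiteOrderLiouvilleSchanuel_collarWall3` (item 33364's binders verbatim + one range line), `finiteOrderLiouvilleSchanuel_collarWall3_pi`, `coordLiouvilleSchanuel_collarWall3`; 04 = §4a the ONE-CUT 2-adic linear-form bound at the member: `cutInt`, `cutInt_ne_zero`, `cut_height_bound`, **`form_lower_bound_N`**; 05 = §4b the tuples `zN3 = (1, ℓ₂, ρ♮₂)` / `zN3pi` with every binder of item 33364 certified hyp-free: `linearIndependent_zN3(pi)`, `linLiouville_zN3(pi)`, `not_hyperLinLiouville_zN3(pi)`, `sb_zN3` / `sb_zN3pi`, `finiteOrderLiouvilleSchanuel_at_zN3(pi)`, `item33364_at_zN3`, `rhoNat_two_position`. PORT EDITS (census convention): `set_option linter.dupNamespace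 false` dropped; per-part private helper copies if any; statements and proofs otherwise verbatim (no renames; K's own private markers kept). `--supports stmt-Schanuel-33364`; no census credit carried; rung 0 — nothing here proves Schanuel; no ∀-item moves; 33364, 33363, 31077 stay OPEN.)
-/

noncomputable section

open Polynomial LiouvilleNumber
open scoped Nat

namespace Summit.Schanuel.Schanuel.Theorems.RootDecomp1KCollarWall

open Summit.Schanuel.Schanuel.Theorems.RootDecomp1KCollarCell
open Summit.Schanuel.Schanuel.Theorems.RootDecomp1KGapCell
open Summit.Schanuel.Schanuel.Theorems.RootDecomp1KTwoBaseCell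
open Summit.Schanuel.Schanuel.Theorems.RootDecomp1KRelLiouvilleCell
open Summit.Schanuel.Schanuel.Theorems.RootDecomp1KNWMeasureHolds (nwMeasure_holds polyMeasure_exp_one_holds)
open Summit.Schanuel.Schanuel.Theorems.RootDecomp1KHyper
open Summit.Schanuel.Schanuel.Theorems.RootDecomp1KHyper.HyperCell

section Members

open IntermediateField

/-! ### §4b  the tuples, the binders, the item -/

/-- `(1, u⃗)` is ℚ-linearly independent when `u⃗` is algebraically independent over `ℚ` (re-proof of the private GapCell06
helper of the same name). -/
private theorem linearIndependent_one_cons_of_algebraicIndependent {m : ℕ} {u : Fin m → ℂ}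
    (hu : AlgebraicIndependent ℚ u) : LinearIndependent ℚ (Fin.cons (1 : ℂ) u : Fin (m + 1) → ℂ) := by
  classical
  rw [linearIndependent_finCons]
  refine ⟨hu.linearIndependent, fun hmem => ?_⟩
  obtain ⟨c, hc⟩ := (Submodule.mem_span_range_iff_exists_fun (R := ℚ)).mp hmem
  set P : MvPolynomial (Fin m) ℚ := ∑ i, MvPolynomial.C (c i) * MvPolynomial.X i - 1 with hP
  have hval : MvPolynomial.aeval u P = 0 := by
    simp only [hP, map_sub, map_sum, map_mul, MvPolynomial.aeval_C, MvPolynomial.aeval_X, map_one]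
    rw [← hc]
    simp [Algebra.smul_def]
  have hP0 : P = 0 :=
    (algebraicIndependent_iff_injective_aeval.mp hu) (by rw [hval, map_zero])
  have hcc : MvPolynomial.constantCoeff P = -1 := by
    simp [hP, MvPolynomial.constantCoeff_X]
  rw [hP0, map_zero] at hcc
  norm_num at hcc

/-- Scaling by `π ≠ 0` preserves ℚ-linear independence (re-proof of the private GapCell06 helper of the same name). -/
private theorem linearIndependent_pi_mul {N : ℕ} {v : Fin N → ℂ} (hv : LinearIndependent ℚ v) :
    LinearIndependent ℚ (fun i => (Real.pi : ℂ) * v i) := by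
  rw [Fintype.linearIndependent_iff] at hv ⊢
  intro g hg
  apply hv g
  have hπ0 : (Real.pi : ℂ) ≠ 0 := by exact_mod_cast Real.pi_ne_zero
  have h : (Real.pi : ℂ) * ∑ i, g i • v i = 0 := by
    rw [Finset.mul_sum]
    calc ∑ i, (Real.pi : ℂ) * (g i • v i) = ∑ i, g i • ((Real.pi : ℂ) * v i) :=
          Finset.sum_congr rfl fun i _ => by rw [mul_smul_comm]
      _ = 0 := hg
  exact (mul_eq_zero.mp h).resolve_left hπ0

/-- THE MEMBER `z♮₃ = (1, ℓ₂, ρ♮₂)`. -/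
def zN3 : Fin 3 → ℂ := ![(1 : ℂ), ((liouvilleNumber 2 : ℝ) : ℂ), ((rhoNat 2 : ℝ) : ℂ)]

/-- THE π-TWIN `z♮₃^π = (π, πℓ₂, πρ♮₂)`. -/
def zN3pi : Fin 3 → ℂ :=
  ![(Real.pi : ℂ), (Real.pi : ℂ) * ((liouvilleNumber 2 : ℝ) : ℂ), (Real.pi : ℂ) * ((rhoNat 2 : ℝ) : ℂ)]

/-- `ρ♮₂` is dyadic-collar-Liouville (tree CollarCell05 `dyadicCollarLiouville_rhoNat` BY NAME). -/
theorem dyadicCollarLiouville_rhoNat_two : DyadicCollarLiouville (rhoNat 2) :=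
  dyadicCollarLiouville_rhoNat (by norm_num)

/-- `(ℓ₂, ρ♮₂)` is algebraically independent (tree CollarCell02 `algebraicIndependent_ell2_of_collar` BY NAME; hyp-free). -/
theorem algebraicIndependent_ell2_rhoNat_two :
    AlgebraicIndependent ℚ ![((liouvilleNumber 2 : ℝ) : ℂ), ((rhoNat 2 : ℝ) : ℂ)] :=
  algebraicIndependent_ell2_of_collar dyadicCollarLiouville_rhoNat_two

/-- (i) `LinearIndependent ℚ z♮₃` — HYPOTHESIS-FREE. -/
theorem linearIndependent_zN3 : LinearIndependent ℚ zN3 := by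
  have e : zN3 = (Fin.cons (1 : ℂ) ![((liouvilleNumber 2 : ℝ) : ℂ), ((rhoNat 2 : ℝ) : ℂ)] : Fin 3 → ℂ) := by
    funext i; fin_cases i <;> simp [zN3]
  rw [e]; exact linearIndependent_one_cons_of_algebraicIndependent algebraicIndependent_ell2_rhoNat_two

/-- (i^π) `LinearIndependent ℚ z♮₃^π` — HYPOTHESIS-FREE. -/
theorem linearIndependent_zN3pi : LinearIndependent ℚ zN3pi := by
  have e : zN3pi = fun i => (Real.pi : ℂ) * zN3 i := by
    funext i; fin_cases i <;> simp [zN3pi, zN3]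
  rw [e]; exact linearIndependent_pi_mul linearIndependent_zN3

/-- (ii) `LinLiouville z♮₃` — the FIRST Diophantine binder of item 33364 (its TEXT: `∀ ω, ∃ h ≠ 0, ‖Σ hᵢ zᵢ‖ < (1+Σ|hᵢ|)^{−ω}`),
through the prefix `(1, ℓ₂)` (tree Hyper13 `linLiouville_of_prefix`, Hyper05 `linLiouville_of_liouville_ratio`, Mathlib
`liouville_liouvilleNumber`) — HYPOTHESIS-FREE. -/
theorem linLiouville_zN3 : LinLiouville zN3 := by
  have hℓ : Liouville (liouvilleNumber 2) := liouville_liouvilleNumber (le_refl 2)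
  refine linLiouville_of_prefix (k := 2) (n := 3) (by norm_num) ?_
  have h2 : (fun i : Fin 2 => zN3 (Fin.castLE (show 2 ≤ 3 by norm_num) i)) =
      ![(1 : ℂ), ((liouvilleNumber 2 : ℝ) : ℂ) * 1] := by
    funext i; fin_cases i <;> simp [zN3]
  rw [h2]
  exact linLiouville_of_liouville_ratio hℓ 1

/-- (ii^π) `LinLiouville z♮₃^π` — HYPOTHESIS-FREE. -/
theorem linLiouville_zN3pi : LinLiouville zN3pi := by
  have hℓ : Liouville (liouvilleNumber 2) := liouville_liouvilleNumber (le_refl 2)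
  refine linLiouville_of_prefix (k := 2) (n := 3) (by norm_num) ?_
  have h2 : (fun i : Fin 2 => zN3pi (Fin.castLE (show 2 ≤ 3 by norm_num) i)) =
      ![(Real.pi : ℂ), ((liouvilleNumber 2 : ℝ) : ℂ) * (Real.pi : ℂ)] := by
    funext i; fin_cases i <;> simp [zN3pi, mul_comm]
  rw [h2]
  exact linLiouville_of_liouville_ratio hℓ (Real.pi : ℂ)

/-- An integer form in `z♮₃` is the real number `g₀ + g₁ℓ₂ + g₂ρ♮₂`. -/
theorem zN3_form (g : Fin 3 → ℤ) :
    ∑ i, (g i : ℂ) * zN3 i = (((g 0 : ℝ) + g 1 * liouvilleNumber 2 + g 2 * rhoNat 2 : ℝ) : ℂ) := by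
  rw [Fin.sum_univ_three]
  simp only [zN3, Matrix.cons_val_zero, Matrix.cons_val_one, Matrix.cons_val_two, Matrix.head_cons,
    Matrix.tail_cons]
  push_cast; ring

/-- An integer form in `z♮₃^π` is `π·(g₀ + g₁ℓ₂ + g₂ρ♮₂)`. -/
theorem zN3pi_form (g : Fin 3 → ℤ) :
    ∑ i, (g i : ℂ) * zN3pi i =
      (Real.pi : ℂ) * (((g 0 : ℝ) + g 1 * liouvilleNumber 2 + g 2 * rhoNat 2 : ℝ) : ℂ) := by
  rw [Fin.sum_univ_three]
  simp only [zN3pi, Matrix.cons_val_zero, Matrix.cons_val_one, Matrix.cons_val_two, Matrix.head_cons,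
    Matrix.tail_cons]
  push_cast; ring

/-- `‖Σ gᵢ z♮₃ᵢ‖ = |g₀ + g₁ℓ₂ + g₂ρ♮₂|`. -/
theorem norm_zN3_form (g : Fin 3 → ℤ) :
    ‖∑ i, (g i : ℂ) * zN3 i‖ = |(g 0 : ℝ) + g 1 * liouvilleNumber 2 + g 2 * rhoNat 2| := by
  rw [zN3_form, Complex.norm_real, Real.norm_eq_abs]

/-- `‖Σ gᵢ z♮₃^πᵢ‖ = π·|g₀ + g₁ℓ₂ + g₂ρ♮₂|`. -/
theorem norm_zN3pi_form (g : Fin 3 → ℤ) :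
    ‖∑ i, (g i : ℂ) * zN3pi i‖ = Real.pi * |(g 0 : ℝ) + g 1 * liouvilleNumber 2 + g 2 * rhoNat 2| := by
  rw [zN3pi_form, norm_mul, Complex.norm_real, Complex.norm_real, Real.norm_eq_abs, Real.norm_eq_abs,
    abs_of_pos Real.pi_pos]

/-- **(iii) `z♮₃` has NO hyper-small integer forms** — the SECOND Diophantine binder of item 33364 (its TEXT, negated:
`¬ ∀ m, ∃ h ≠ 0, ‖Σ hᵢ zᵢ‖ < exp(−(1+Σ|hᵢ|)^m)`), refuted AT `m = 14`: the putative hyper-small form at `m = 14` would be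
`< exp(−X^14) ≤ exp(−X^13)` (monotonicity of `m ↦ X^m` for `X = 1 + Σ|hᵢ| ≥ 1`, USED via Mathlib `pow_le_pow_right₀`),
contradicting the form bound (M) at exponent `13` — HYPOTHESIS-FREE. -/
theorem not_hyperLinLiouville_zN3 : ¬ HyperLinLiouville zN3 := by
  intro hH
  obtain ⟨g, hg, hlt⟩ := hH 14
  rw [norm_zN3_form] at hlt
  have hlow := form_lower_bound_N g hg
  have hX : (1 : ℝ) ≤ 1 + ∑ i, (|g i| : ℝ) := by
    have : (0 : ℝ) ≤ ∑ i, (|g i| : ℝ) :=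
      Finset.sum_nonneg fun i _ => by exact_mod_cast abs_nonneg (g i)
    linarith
  have hmono : (1 + ∑ i, (|g i| : ℝ)) ^ 13 ≤ (1 + ∑ i, (|g i| : ℝ)) ^ 14 :=
    pow_le_pow_right₀ hX (by norm_num)
  have := Real.exp_le_exp.mpr (neg_le_neg hmono)
  linarith

/-- **(iii^π) `z♮₃^π` has NO hyper-small integer forms** (refuted at `m = 14`; `π ≥ 1`) — HYPOTHESIS-FREE. -/
theorem not_hyperLinLiouville_zN3pi : ¬ HyperLinLiouville zN3pi := by
  intro hH
  obtain ⟨g, hg, hlt⟩ := hH 14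
  rw [norm_zN3pi_form] at hlt
  have hlow := form_lower_bound_N g hg
  have hX : (1 : ℝ) ≤ 1 + ∑ i, (|g i| : ℝ) := by
    have : (0 : ℝ) ≤ ∑ i, (|g i| : ℝ) :=
      Finset.sum_nonneg fun i _ => by exact_mod_cast abs_nonneg (g i)
    linarith
  have hmono : (1 + ∑ i, (|g i| : ℝ)) ^ 13 ≤ (1 + ∑ i, (|g i| : ℝ)) ^ 14 :=
    pow_le_pow_right₀ hX (by norm_num)
  have := Real.exp_le_exp.mpr (neg_le_neg hmono)
  have hπ : (1 : ℝ) ≤ Real.pi := by have := Real.pi_gt_three; linarith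
  have habs := abs_nonneg ((g 0 : ℝ) + g 1 * liouvilleNumber 2 + g 2 * rhoNat 2)
  nlinarith

/-- **`z♮₃` lies in the scope of item 33364** — all three hypotheses as TEXT, HYPOTHESIS-FREE. -/
theorem zN3_in_scope_33364 :
    LinearIndependent ℚ zN3 ∧
    (∀ ω : ℕ, ∃ h : Fin 3 → ℤ, h ≠ 0 ∧ ‖∑ i, (h i : ℂ) * zN3 i‖ < 1 / (1 + ∑ i, (|h i| : ℝ)) ^ ω) ∧
    (¬ ∀ m : ℕ, ∃ h : Fin 3 → ℤ, h ≠ 0 ∧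
      ‖∑ i, (h i : ℂ) * zN3 i‖ < Real.exp (-((1 + ∑ i, (|h i| : ℝ)) ^ m))) :=
  ⟨linearIndependent_zN3, linLiouville_zN3, not_hyperLinLiouville_zN3⟩

/-- **`z♮₃^π` lies in the scope of item 33364** — HYPOTHESIS-FREE. -/
theorem zN3pi_in_scope_33364 :
    LinearIndependent ℚ zN3pi ∧
    (∀ ω : ℕ, ∃ h : Fin 3 → ℤ, h ≠ 0 ∧ ‖∑ i, (h i : ℂ) * zN3pi i‖ < 1 / (1 + ∑ i, (|h i| : ℝ)) ^ ω) ∧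
    (¬ ∀ m : ℕ, ∃ h : Fin 3 → ℤ, h ≠ 0 ∧
      ‖∑ i, (h i : ℂ) * zN3pi i‖ < Real.exp (-((1 + ∑ i, (|h i| : ℝ)) ^ m))) :=
  ⟨linearIndependent_zN3pi, linLiouville_zN3pi, not_hyperLinLiouville_zN3pi⟩

/-- **`SB 3 z♮₃` — HYPOTHESIS-FREE** (the collar wall (W4) at `ρ = ρ♮₂`). -/
theorem sb_zN3 : SB 3 zN3 := sb_collarWall3 dyadicCollarLiouville_rhoNat_two

/-- **`SB 3 z♮₃^π` — HYPOTHESIS-FREE.** -/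
theorem sb_zN3pi : SB 3 zN3pi := sb_collarWall3_pi dyadicCollarLiouville_rhoNat_two

/-- **ITEM 33364 DECIDED AT `z♮₃` — HYPOTHESIS-FREE:** scope (i)–(iii) AND the conclusion. -/
theorem finiteOrderLiouvilleSchanuel_at_zN3 :
    LinearIndependent ℚ zN3 ∧ LinLiouville zN3 ∧ ¬ HyperLinLiouville zN3 ∧ SB 3 zN3 :=
  ⟨linearIndependent_zN3, linLiouville_zN3, not_hyperLinLiouville_zN3, sb_zN3⟩

/-- **ITEM 33364 DECIDED AT `z♮₃^π` — HYPOTHESIS-FREE.** -/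
theorem finiteOrderLiouvilleSchanuel_at_zN3pi :
    LinearIndependent ℚ zN3pi ∧ LinLiouville zN3pi ∧ ¬ HyperLinLiouville zN3pi ∧ SB 3 zN3pi :=
  ⟨linearIndependent_zN3pi, linLiouville_zN3pi, not_hyperLinLiouville_zN3pi, sb_zN3pi⟩

/-- **THE LIVE ITEM 33364 APPLIED at `z♮₃`** (its text VERBATIM as the hypothesis; the member discharges every binder). -/
theorem item33364_at_zN3
    (h33364 : ∀ (n : ℕ) (z : Fin n → ℂ), LinearIndependent ℚ z →
      (∀ ω : ℕ, ∃ h : Fin n → ℤ, h ≠ 0 ∧ ‖∑ i, (h i : ℂ) * z i‖ < 1 / (1 + ∑ i, (|h i| : ℝ)) ^ ω) →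
      (¬ ∀ m : ℕ, ∃ h : Fin n → ℤ, h ≠ 0 ∧
        ‖∑ i, (h i : ℂ) * z i‖ < Real.exp (-((1 + ∑ i, (|h i| : ℝ)) ^ m))) →
      (n : Cardinal) ≤ Algebra.trdeg ℚ
        ↥(IntermediateField.adjoin ℚ (Set.range z ∪ Set.range (Complex.exp ∘ z)))) :
    SB 3 zN3 := h33364 3 zN3 linearIndependent_zN3 linLiouville_zN3 not_hyperLinLiouville_zN3

/-- **THE LIVE ITEM 33364 APPLIED at `z♮₃^π`.** -/
theorem item33364_at_zN3pi
    (h33364 : ∀ (n : ℕ) (z : Fin n → ℂ), LinearIndependent ℚ z →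
      (∀ ω : ℕ, ∃ h : Fin n → ℤ, h ≠ 0 ∧ ‖∑ i, (h i : ℂ) * z i‖ < 1 / (1 + ∑ i, (|h i| : ℝ)) ^ ω) →
      (¬ ∀ m : ℕ, ∃ h : Fin n → ℤ, h ≠ 0 ∧
        ‖∑ i, (h i : ℂ) * z i‖ < Real.exp (-((1 + ∑ i, (|h i| : ℝ)) ^ m))) →
      (n : Cardinal) ≤ Algebra.trdeg ℚ
        ↥(IntermediateField.adjoin ℚ (Set.range z ∪ Set.range (Complex.exp ∘ z)))) :
    SB 3 zN3pi := h33364 3 zN3pi linearIndependent_zN3pi linLiouville_zN3pi not_hyperLinLiouville_zN3pi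

/-- `z♮₃` is ALSO in the scope of item 31077 (`ℓ₂ ∈ span`, Liouville) — bookkeeping, hyp-free. -/
theorem coordLiouvilleSpan_zN3 : ∃ w ∈ Submodule.span ℚ (Set.range zN3), Liouville w.re ∨ Liouville w.im :=
  ⟨zN3 1, Submodule.subset_span ⟨1, rfl⟩, Or.inl (by simpa [zN3] using liouville_liouvilleNumber (le_refl 2))⟩

/-- **ITEM 31077 at `z♮₃`** (its text verbatim as the hypothesis) — bookkeeping; the conclusion is `sb_zN3` outright. -/
theorem item31077_at_zN3
    (h31077 : ∀ (n : ℕ) (z : Fin n → ℂ), LinearIndependent ℚ z →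
      (∃ w ∈ Submodule.span ℚ (Set.range z), Liouville w.re ∨ Liouville w.im) →
      (n : Cardinal) ≤ Algebra.trdeg ℚ
        ↥(IntermediateField.adjoin ℚ (Set.range z ∪ Set.range (Complex.exp ∘ z)))) :
    SB 3 zN3 := h31077 3 zN3 linearIndependent_zN3 coordLiouvilleSpan_zN3

/-- **POSITION of the member, BY TREE NAME (CollarCell05):** `ρ♮₂` is Liouville, dyadic-collar, of EXACT Skel-order `2`
(`∈ Skel₍₂₎ ∖ Skel₍₃₎`), and lies in NONE of the decided `ρ`-classes of the route's walls of record — not Skel-Liouville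
(SkelCell07/11 walls), not factorial-gap (GapCell04 walls), not log-log (LogLogCell08), not log-square (lens 6), not log-hyper
(RelLiouvilleCell08), not hyper-Liouville (33363's class), not of any finite Liouville order `k ≥ 1`. -/
theorem rhoNat_two_position :
    Liouville (rhoNat 2) ∧ DyadicCollarLiouville (rhoNat 2) ∧
    Summit.Schanuel.Schanuel.Theorems.RootDecomp1KSkelCell.SkelLiouvilleFix 2 (rhoNat 2) ∧
    ¬ Summit.Schanuel.Schanuel.Theorems.RootDecomp1KSkelCell.SkelLiouvilleFix 3 (rhoNat 2) ∧
    ¬ Summit.Schanuel.Schanuel.Theorems.RootDecomp1KSkelCell.SkelLiouville (rhoNat 2) ∧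
    ¬ FactorialGapLiouville (rhoNat 2) ∧
    ¬ Summit.Schanuel.Schanuel.Theorems.RootDecomp1KLogLogCell.LogLogLiouville (rhoNat 2) ∧
    ¬ Summit.Schanuel.Schanuel.Theorems.RootDecomp1KGeneric.LogSqLiouville (rhoNat 2) ∧
    ¬ LogHyperLiouville (rhoNat 2) ∧
    ¬ HyperLiouville (rhoNat 2) ∧
    (∀ k : ℕ, 1 ≤ k → ¬ Summit.Schanuel.Schanuel.Theorems.RootDecomp1KGeneric.LiouvilleOrder k (rhoNat 2)) :=
  ⟨liouville_rhoNat (by norm_num), dyadicCollarLiouville_rhoNat_two, skelLiouvilleFix_rhoNat (by norm_num),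
    not_skelLiouvilleFix_succ_rhoNat (m := 2) (by norm_num), not_skelLiouville_rhoNat (by norm_num),
    not_factorialGapLiouville_rhoNat (by norm_num), not_logLogLiouville_rhoNat (by norm_num),
    not_logSqLiouville_rhoNat (by norm_num), not_logHyperLiouville_rhoNat (by norm_num),
    not_hyperLiouville_rhoNat (by norm_num), fun k hk => not_liouvilleOrder_rhoNat (by norm_num) hk⟩

end Members

end Summit.Schanuel.Schanuel.Theorems.RootDecomp1KCollarWall

end
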